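import Summits.KontsevichZagierPeriods.KontsevichZagierPeriods.Theses.IsogenyCertificates
import Literature.NumberTheory.Transcendental.KZCalculus
import Literature.NumberTheory.EllipticCurves.RealLatticePeriod
import Literature.NumberTheory.EllipticCurves.RealLatticePeriodProofs
import Mathlib.Analysis.Calculus.Deriv.Inverse
import Mathlib.Topology.Order.MonotoneContinuity
import HarnessLib

/-!
# Stub `stub_uniformizedBranch` (crux `RealPeriodSectorComplete`, line `period-ratio-branch-cov`)

Let `Λ, Λ'` be real lattices with least positive real periods `Ω`, `Ω' = βΩ` (`β > 0`
rational) and invariants `g₂ = -4A, g₃ = -4B`, `g₂' = -4A', g₃' = -4B'`, so that on the real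
axis `℘'² = 4(℘³ + A℘ + B)`.  The real function `t ↦ ℘_Λ(t)` is a strictly decreasing `C¹`
bijection `(0, Ω/2) → (e, ∞)`, `e = ℘_Λ(Ω/2)` (`PeriodPair.IsReal.strictAntiOn_weierstrassPRe`,
`PeriodPair.IsReal.image_weierstrassPRe_Ioo`); let `ψ : (e, ∞) → (0, Ω/2)` be its inverse
(spelled out as `Function.invFunOn L.weierstrassPRe (Ioo 0 (L.minRealPeriod / 2))` throughout, so
that this file stays a pure proof file).  The **uniformized branch** `Φ x = ℘_{Λ'}(β ψ x)` is
then a strictly increasing bijection `(e, ∞) → (e', ∞)` (`e' = ℘_{Λ'}(Ω'/2)`) with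
`Φ' x = β √(Φ x³ + A'Φ x + B') / √(x³ + Ax + B)` (chain rule and `℘' = -2√(℘³ + A℘ + B)` on the
open half-period, where `℘' < 0`), and by construction `℘_Λ(z) = x`, `℘_{Λ'}(βz) = Φ x` for
`z = ψ x ∈ (0, Ω/2)`.  Pure one-variable real calculus on top of the proved tree API
(`RealLatticePeriod.lean`, `RealLatticePeriodProofs.lean`).
-/

noncomputable section

open MeasureTheory Set Filter Topology
open scoped PeriodPair

namespace Summit.KontsevichZagierPeriods.IsogenyCertificates.RealPeriodSectorCompleteStubs.UniformizedBranch

variable {L : PeriodPair}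

/-- For `x > e`: `ψ x ∈ (0, Ω/2)` and `℘(ψ x) = x`. [folklore] -/
lemma psi_spec (h : L.IsReal) {x : ℝ} (hx : L.weierstrassPRe (L.minRealPeriod / 2) < x) :
    Function.invFunOn L.weierstrassPRe (Ioo 0 (L.minRealPeriod / 2)) x ∈
        Ioo 0 (L.minRealPeriod / 2) ∧
      L.weierstrassPRe (Function.invFunOn L.weierstrassPRe (Ioo 0 (L.minRealPeriod / 2)) x) =
        x := by
  have hx' : x ∈ L.weierstrassPRe '' Ioo 0 (L.minRealPeriod / 2) := by
    rw [h.image_weierstrassPRe_Ioo]; exact hx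
  obtain ⟨a, ha, hax⟩ := hx'
  exact Function.invFunOn_pos ⟨a, ha, hax⟩

/-- `ψ(℘ z) = z` for `z ∈ (0, Ω/2)`. [folklore] -/
lemma psi_weierstrassPRe (h : L.IsReal) {z : ℝ} (hz : z ∈ Ioo 0 (L.minRealPeriod / 2)) :
    Function.invFunOn L.weierstrassPRe (Ioo 0 (L.minRealPeriod / 2)) (L.weierstrassPRe z) = z :=
  (h.strictAntiOn_weierstrassPRe.injOn.mono Ioo_subset_Ioc_self).leftInvOn_invFunOn hz

/-- `℘ z > e` for `z ∈ (0, Ω/2)`. [folklore] -/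
lemma lt_weierstrassPRe (h : L.IsReal) {z : ℝ} (hz : z ∈ Ioo 0 (L.minRealPeriod / 2)) :
    L.weierstrassPRe (L.minRealPeriod / 2) < L.weierstrassPRe z := by
  have : L.weierstrassPRe z ∈ L.weierstrassPRe '' Ioo 0 (L.minRealPeriod / 2) := ⟨z, hz, rfl⟩
  rw [h.image_weierstrassPRe_Ioo] at this
  exact this

/-- `ψ` is strictly decreasing on `(e, ∞)`. [folklore] -/
lemma strictAntiOn_psi (h : L.IsReal) :
    StrictAntiOn (Function.invFunOn L.weierstrassPRe (Ioo 0 (L.minRealPeriod / 2)))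
      (Ioi (L.weierstrassPRe (L.minRealPeriod / 2))) := by
  set ψ := Function.invFunOn L.weierstrassPRe (Ioo 0 (L.minRealPeriod / 2)) with hψ
  intro x hx y hy hxy
  obtain ⟨hψx, hpx⟩ := psi_spec h hx
  obtain ⟨hψy, hpy⟩ := psi_spec h hy
  rw [← hψ] at hψx hpx hψy hpy
  by_contra hle
  have hle' : ψ x ≤ ψ y := not_lt.mp hle
  have := h.strictAntiOn_weierstrassPRe.antitoneOn (Ioo_subset_Ioc_self hψx)
    (Ioo_subset_Ioc_self hψy) hle'
  rw [hpx, hpy] at this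
  exact absurd hxy (not_lt.mpr this)

/-- `ψ` is continuous on `(e, ∞)` (a strictly monotone map onto an open interval). [folklore] -/
lemma continuousAt_psi (h : L.IsReal) {x : ℝ} (hx : L.weierstrassPRe (L.minRealPeriod / 2) < x) :
    ContinuousAt (Function.invFunOn L.weierstrassPRe (Ioo 0 (L.minRealPeriod / 2))) x := by
  set ψ := Function.invFunOn L.weierstrassPRe (Ioo 0 (L.minRealPeriod / 2)) with hψ
  have hmono : StrictMonoOn (fun y ↦ -ψ y) (Ioi (L.weierstrassPRe (L.minRealPeriod / 2))) :=
    fun a ha b hb hab ↦ neg_lt_neg (strictAntiOn_psi h ha hb hab)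
  have hψx := (psi_spec h hx).1
  rw [← hψ] at hψx
  have himg : (fun y ↦ -ψ y) '' Ioi (L.weierstrassPRe (L.minRealPeriod / 2)) ∈ 𝓝 (-ψ x) := by
    refine mem_of_superset (Ioo_mem_nhds (neg_lt_neg hψx.2) (neg_lt_neg hψx.1)) ?_
    intro w hw
    have hz : -w ∈ Ioo 0 (L.minRealPeriod / 2) := ⟨by linarith [hw.2], by linarith [hw.1]⟩
    refine ⟨L.weierstrassPRe (-w), lt_weierstrassPRe h hz, ?_⟩
    have := psi_weierstrassPRe h hz
    rw [← hψ] at this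
    simp only [this, neg_neg]
  have hcont : ContinuousAt (fun y ↦ -ψ y) x :=
    hmono.continuousAt_of_image_mem_nhds (Ioi_mem_nhds hx) himg
  have heq : -(fun y ↦ -ψ y) = ψ := by ext y; simp
  have hcont' : ContinuousAt (-(fun y ↦ -ψ y)) x := hcont.neg
  rwa [heq] at hcont'

/-- `ψ' x = 1/℘'(ψ x)` for `x > e` (derivative of the inverse function). [folklore] -/
lemma hasDerivAt_psi (h : L.IsReal) {x : ℝ} (hx : L.weierstrassPRe (L.minRealPeriod / 2) < x) :
    HasDerivAt (Function.invFunOn L.weierstrassPRe (Ioo 0 (L.minRealPeriod / 2)))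
      (L.derivWeierstrassPRe
        (Function.invFunOn L.weierstrassPRe (Ioo 0 (L.minRealPeriod / 2)) x))⁻¹ x := by
  obtain ⟨hψx, -⟩ := psi_spec h hx
  have hΩ := h.minRealPeriod_pos
  have hnot :
      ((Function.invFunOn L.weierstrassPRe (Ioo 0 (L.minRealPeriod / 2)) x : ℝ) : ℂ) ∉
        L.lattice :=
    h.ofReal_notMem_lattice hψx.1 (by linarith [hψx.2])
  refine HasDerivAt.of_local_left_inverse (continuousAt_psi h hx)
    (PeriodPair.hasDerivAt_weierstrassPRe hnot) (h.derivWeierstrassPRe_neg hψx.1 hψx.2).ne ?_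
  filter_upwards [Ioi_mem_nhds hx] with y hy
  exact (psi_spec h hy).2

/-- On `(0, Ω/2)`: `℘' = -2√(℘³ + A℘ + B)` and `℘³ + A℘ + B > 0`, when `g₂ = -4A`, `g₃ = -4B`
(real form of `℘'² = 4℘³ − g₂℘ − g₃` together with `℘' < 0`). [folklore] -/
lemma derivWeierstrassPRe_eq (h : L.IsReal) {A B : ℤ} (hg₂ : L.g₂ = -4 * (A : ℂ))
    (hg₃ : L.g₃ = -4 * (B : ℂ)) {z : ℝ} (hz : z ∈ Ioo 0 (L.minRealPeriod / 2)) :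
    L.derivWeierstrassPRe z =
        -(2 * Real.sqrt (L.weierstrassPRe z ^ 3 + (A : ℝ) * L.weierstrassPRe z + (B : ℝ))) ∧
      0 < L.weierstrassPRe z ^ 3 + (A : ℝ) * L.weierstrassPRe z + (B : ℝ) := by
  have hΩ := h.minRealPeriod_pos
  have hnot : ((z : ℝ) : ℂ) ∉ L.lattice := h.ofReal_notMem_lattice hz.1 (by linarith [hz.2])
  have hneg := h.derivWeierstrassPRe_neg hz.1 hz.2
  have hsq := h.derivWeierstrassPRe_sq hnot
  have h2 : L.g₂.re = -4 * (A : ℝ) := by rw [hg₂]; simp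
  have h3 : L.g₃.re = -4 * (B : ℝ) := by rw [hg₃]; simp
  rw [h2, h3] at hsq
  set P := L.weierstrassPRe z ^ 3 + (A : ℝ) * L.weierstrassPRe z + (B : ℝ) with hP
  have hsq' : L.derivWeierstrassPRe z ^ 2 = 4 * P := by rw [hsq, hP]; ring
  have hPpos : 0 < P := by nlinarith [mul_pos_of_neg_of_neg hneg hneg]
  refine ⟨?_, hPpos⟩
  have h1 : (-L.derivWeierstrassPRe z) ^ 2 = (2 * Real.sqrt P) ^ 2 := by
    rw [neg_sq, mul_pow, Real.sq_sqrt hPpos.le, hsq']; ring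
  have h4 := (sq_eq_sq₀ (by linarith) (by positivity)).mp h1
  linarith

/-- **Stub `stub_uniformizedBranch`**: for real lattices `Λ, Λ'` with `Ω' = βΩ` the uniformized
branch `Φ = ℘_{Λ'} ∘ (β ·) ∘ ℘_Λ⁻¹` is a strictly increasing bijection `(e, ∞) → (e', ∞)` with
`Φ' = β √P'(Φ)/√P`, and `℘_Λ(z) = x`, `℘_{Λ'}(βz) = Φ x` for some `z ∈ (0, Ω/2)`. [folklore] -/
theorem stub_uniformizedBranch : ∀ (A B A' B' : ℤ) (L L' : PeriodPair), L.IsReal → L'.IsReal → L.g₂ = -4 * (A : ℂ) → L.g₃ = -4 * (B : ℂ) → L'.g₂ = -4 * (A' : ℂ) → L'.g₃ = -4 * (B' : ℂ) → ∀ (β : ℚ), 0 < β → L'.minRealPeriod = (β : ℝ) * L.minRealPeriod → ∃ Φ : ℝ → ℝ, StrictMonoOn Φ (Ioi (L.weierstrassPRe (L.minRealPeriod / 2))) ∧ Φ '' Ioi (L.weierstrassPRe (L.minRealPeriod / 2)) = Ioi (L'.weierstrassPRe (L'.minRealPeriod / 2)) ∧ (∀ x : ℝ, L.weierstrassPRe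 (L.minRealPeriod / 2) < x → HasDerivAt Φ ((β : ℝ) * Real.sqrt (Φ x ^ 3 + (A' : ℝ) * Φ x + (B' : ℝ)) / Real.sqrt (x ^ 3 + (A : ℝ) * x + (B : ℝ))) x) ∧ ∀ x : ℝ, L.weierstrassPRe (L.minRealPeriod / 2) < x → ∃ z : ℝ, 0 < z ∧ z < L.minRealPeriod / 2 ∧ ℘[L] (z : ℂ) = (x : ℂ) ∧ ℘[L'] ((β : ℂ) * (z : ℂ)) = (Φ x : ℂ) := by
  intro A B A' B' L L' hL hL' hg₂ hg₃ hg₂' hg₃' β hβ hper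
  have hΩ := hL.minRealPeriod_pos
  have hΩ' := hL'.minRealPeriod_pos
  have hβr : (0 : ℝ) < β := by exact_mod_cast hβ
  -- the inverse `ψ : (e, ∞) → (0, Ω/2)` of `℘_Λ` on the open real half-period
  set ψ := Function.invFunOn L.weierstrassPRe (Ioo 0 (L.minRealPeriod / 2)) with hψ
  have hspec : ∀ x, L.weierstrassPRe (L.minRealPeriod / 2) < x →
      ψ x ∈ Ioo 0 (L.minRealPeriod / 2) ∧ L.weierstrassPRe (ψ x) = x :=
    fun x hx ↦ psi_spec hL hx
  -- `β z ∈ (0, Ω'/2)` for `z ∈ (0, Ω/2)`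
  have hβz : ∀ z ∈ Ioo 0 (L.minRealPeriod / 2), (β : ℝ) * z ∈ Ioo 0 (L'.minRealPeriod / 2) := by
    intro z hz
    refine ⟨mul_pos hβr hz.1, ?_⟩
    rw [hper]
    nlinarith [hz.2]
  refine ⟨fun x ↦ L'.weierstrassPRe ((β : ℝ) * ψ x), ?_, ?_, ?_, ?_⟩
  · -- strictly increasing: composition of two strictly decreasing maps
    intro x hx y hy hxy
    have hlt : ψ y < ψ x := strictAntiOn_psi hL hx hy hxy
    have hx' := hβz _ (hspec x hx).1
    have hy' := hβz _ (hspec y hy).1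
    exact hL'.strictAntiOn_weierstrassPRe (Ioo_subset_Ioc_self hy') (Ioo_subset_Ioc_self hx')
      (mul_lt_mul_of_pos_left hlt hβr)
  · -- the image is `(e', ∞)`
    apply Subset.antisymm
    · rintro _ ⟨x, hx, rfl⟩
      exact lt_weierstrassPRe hL' (hβz _ (hspec x hx).1)
    · intro y hy
      have hy' : y ∈ L'.weierstrassPRe '' Ioo 0 (L'.minRealPeriod / 2) := by
        rw [hL'.image_weierstrassPRe_Ioo]; exact hy
      obtain ⟨w, hw, rfl⟩ := hy'
      have hz : w / β ∈ Ioo 0 (L.minRealPeriod / 2) := by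
        refine ⟨div_pos hw.1 hβr, ?_⟩
        rw [div_lt_iff₀ hβr]
        rw [hper] at hw
        nlinarith [hw.2]
      refine ⟨L.weierstrassPRe (w / β), lt_weierstrassPRe hL hz, ?_⟩
      have hψw : ψ (L.weierstrassPRe (w / β)) = w / β := psi_weierstrassPRe hL hz
      simp only [hψw, mul_div_cancel₀ _ hβr.ne']
  · -- the derivative (chain rule, inverse function rule, `℘' = -2√(℘³ + A℘ + B)`)
    intro x hx
    obtain ⟨hψx, hpx⟩ := hspec x hx
    have hβψ := hβz _ hψx
    have hnot' : (((β : ℝ) * ψ x : ℝ) : ℂ) ∉ L'.lattice :=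
      hL'.ofReal_notMem_lattice hβψ.1 (by linarith [hβψ.2])
    have hdψ : HasDerivAt ψ (L.derivWeierstrassPRe (ψ x))⁻¹ x := hasDerivAt_psi hL hx
    have hd := (PeriodPair.hasDerivAt_weierstrassPRe hnot').comp x (hdψ.const_mul (β : ℝ))
    refine hd.congr_deriv ?_
    obtain ⟨hq, hP⟩ := derivWeierstrassPRe_eq hL hg₂ hg₃ hψx
    obtain ⟨hq', -⟩ := derivWeierstrassPRe_eq hL' hg₂' hg₃' hβψ
    rw [hq, hq', hpx]
    rw [hpx] at hP
    have hs : Real.sqrt (x ^ 3 + (A : ℝ) * x + (B : ℝ)) ≠ 0 := (Real.sqrt_pos.mpr hP).ne'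
    field_simp
  · -- the uniformization identities
    intro x hx
    obtain ⟨hψx, hpx⟩ := hspec x hx
    refine ⟨ψ x, hψx.1, hψx.2, ?_, ?_⟩
    · rw [← hL.ofReal_weierstrassPRe, hpx]
    · have : (β : ℂ) * ((ψ x : ℝ) : ℂ) = (((β : ℝ) * ψ x : ℝ) : ℂ) := by push_cast; ring
      rw [this, ← hL'.ofReal_weierstrassPRe]

end Summit.KontsevichZagierPeriods.IsogenyCertificates.RealPeriodSectorCompleteStubs.UniformizedBranch

end
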